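import Literature.MathematicalPhysics.QuantumManyBody.YukawaFourier
import Literature.MathematicalPhysics.QuantumManyBody.FourierPositiveType
import HarnessLib

/-!
# The Fourier transform of a smeared Yukawa potential `h · Y_ω`

Topic `Literature/MathematicalPhysics/QuantumManyBody` (electrostatics groundwork for the charged
Bose gas, `JelliumBoseGas.foldyLaw`; step towards [ConlonLiebYau1988, Lemma 2.1]). The CLY kernel
is `K = Y_ν - h·Y_ω` with `Y_μ(x) = e^{-μ|x|}/|x|` and a smooth even cutoff `h`; its Fourier
transform is `𝓕Y_ν - ĥ ∗ 𝓕Y_ω`. This file proves the convolution formula for the second term: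
for `h : ℝ³ → ℝ` continuous and integrable with `𝓕h ∈ L¹` and `m > 0`,

**`𝓕(h · e^{-√m|·|}/|·|)(p) = ∫ 𝓕h(q) · 4π/(4π²|p - q|² + m) dq`**

(Fourier inversion `h = 𝓕⁻𝓕h`, Fubini, and `𝓕(e^{-√m|·|}/|·|)(ξ) = 4π/(4π²|ξ|² + m)`,
`Coulomb.fourierIntegral_yukawa'`), together with the real form for even `h` (then `𝓕h` is real):
`𝓕(hY)(p) = ∫ Re𝓕h(q) · 4π/(4π²|p - q|² + m) dq`.

* `Coulomb.integrable_yukawa` — `e^{-√m|·|}/|·| ∈ L¹(ℝ³)`.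
* `Coulomb.norm_le_integral_norm_fourier` — `|h(x)| ≤ ‖𝓕h‖₁` (so `h·Y ∈ L¹`).
* `Coulomb.fourier_smearedYukawa` — **the convolution formula** (complex form).
* `Coulomb.fourier_smearedYukawa_re` — the real form for even `h`.

## References

* [ConlonLiebYau1988] J. G. Conlon, E. H. Lieb, H.-T. Yau, Commun. Math. Phys. 116 (1988) 417–448,
  Lemma 2.1 (proof).
* [LiebLoss2001] E. H. Lieb, M. Loss, *Analysis*, 2nd ed. (2001), Thm. 5.8 (convolution theorem)
  and Thm. 6.23 (Yukawa potential).
-/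

noncomputable section

open MeasureTheory Set Filter Real
open scoped ENNReal NNReal Topology FourierTransform InnerProductSpace

namespace Literature.MathematicalPhysics.QuantumManyBody.Coulomb

open BoseGas Literature.Analysis.UnboundedOperators

/-- **The Yukawa potential is integrable on `ℝ³`**: `e^{-√m|x|}/|x| ∈ L¹` for `m > 0` (it is `4π`
times the subordinated kernel `∫₀^∞ e^{-ms}G_s ds` a.e., whose mass is `1/m`). [folklore] -/
theorem integrable_yukawa {m : ℝ} (hm : 0 < m) :
    Integrable fun x : Space => Real.exp (-(Real.sqrt m * ‖x‖)) / ‖x‖ := by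
  obtain ⟨-, hint, -⟩ := integral_yukawaKernel hm
  have hae : ∀ᵐ y : Space ∂volume, y ≠ 0 := by
    have : (volume : Measure Space) {y | ¬y ≠ 0} = 0 := by
      simp only [ne_eq, not_not, setOf_eq_eq_singleton, measure_singleton]
    exact ae_iff.2 this
  refine (hint.const_mul (4 * π)).congr ?_
  filter_upwards [hae] with y hy
  rw [(integral_Ioi_exp_neg_mul_heatKernel hy hm).2]
  have hyn : ‖y‖ ≠ 0 := norm_ne_zero_iff.2 hy
  have hπ : (π : ℝ) ≠ 0 := Real.pi_pos.ne'
  field_simp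

/-- **A function with integrable Fourier transform is bounded by `‖𝓕h‖₁`**: if `h` is continuous,
integrable and `𝓕h ∈ L¹` then `|h(x)| ≤ ∫ ‖𝓕h‖` (Fourier inversion). [folklore] -/
theorem norm_le_integral_norm_fourier {h : Space → ℝ} (hhc : Continuous h) (hhi : Integrable h)
    (hH : Integrable (𝓕 (fun x : Space => (h x : ℂ)))) (x : Space) :
    ‖h x‖ ≤ ∫ q, ‖𝓕 (fun x : Space => (h x : ℂ)) q‖ := by
  have hcont : Continuous fun x : Space => (h x : ℂ) := Complex.continuous_ofReal.comp hhc
  have hinv := hcont.fourierInv_fourier_eq hhi.ofReal hH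
  have hx : (h x : ℂ) = 𝓕⁻ (𝓕 (fun x : Space => (h x : ℂ))) x := by rw [hinv]
  rw [← Complex.norm_real, hx, Real.fourierInv_eq]
  refine (norm_integral_le_integral_norm _).trans (le_of_eq ?_)
  refine integral_congr_ae (Eventually.of_forall fun q => ?_)
  simp only [Circle.smul_def, smul_eq_mul, norm_mul, Circle.norm_coe, one_mul]

/-- `h · Y_m ∈ L¹` under the hypotheses of `fourier_smearedYukawa`. [folklore] -/
theorem integrable_mul_yukawa {h : Space → ℝ} (hhc : Continuous h) (hhi : Integrable h)
    (hH : Integrable (𝓕 (fun x : Space => (h x : ℂ)))) {m : ℝ} (hm : 0 < m) :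
    Integrable fun x : Space => h x * (Real.exp (-(Real.sqrt m * ‖x‖)) / ‖x‖) :=
  (integrable_yukawa hm).bdd_mul (c := ∫ q, ‖𝓕 (fun x : Space => (h x : ℂ)) q‖)
    hhc.aestronglyMeasurable (Eventually.of_forall (norm_le_integral_norm_fourier hhc hhi hH))

/-- **Fourier transform of a smeared Yukawa potential** [ConlonLiebYau1988, Lemma 2.1 (proof)]:
for `h : ℝ³ → ℝ` continuous and integrable with `𝓕h` integrable, and `m > 0`,
`𝓕(h · e^{-√m|·|}/|·|)(p) = ∫ 𝓕h(q) · 4π/(4π²|p - q|² + m) dq` — the convolution of `𝓕h` with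
the Fourier transform of the Yukawa potential. [cite: LiebLoss2001, Thm. 5.8] -/
theorem fourier_smearedYukawa {h : Space → ℝ} (hhc : Continuous h) (hhi : Integrable h)
    (hH : Integrable (𝓕 (fun x : Space => (h x : ℂ)))) {m : ℝ} (hm : 0 < m) (p : Space) :
    𝓕 (fun x : Space => ((h x * (Real.exp (-(Real.sqrt m * ‖x‖)) / ‖x‖) : ℝ) : ℂ)) p =
      ∫ q, 𝓕 (fun x : Space => (h x : ℂ)) q *
        ((4 * π / (4 * π ^ 2 * ‖p - q‖ ^ 2 + m) : ℝ) : ℂ) := by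
  -- notation
  set FH : Space → ℂ := 𝓕 (fun x : Space => (h x : ℂ)) with hFH
  set Yc : Space → ℂ := fun x => ((Real.exp (-(Real.sqrt m * ‖x‖)) / ‖x‖ : ℝ) : ℂ) with hYc
  have hYi : Integrable Yc := (integrable_yukawa hm).ofReal
  -- Fourier inversion for `h`
  have hcont : Continuous fun x : Space => (h x : ℂ) := Complex.continuous_ofReal.comp hhc
  have hinv := hcont.fourierInv_fourier_eq hhi.ofReal hH
  have hx : ∀ x : Space, (h x : ℂ) =
      ∫ q, Complex.exp (((2 * π * ⟪q, x⟫_ℝ : ℝ) : ℂ) * Complex.I) * FH q := by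
    intro x
    have e : (h x : ℂ) = 𝓕⁻ (𝓕 (fun x : Space => (h x : ℂ))) x := by rw [hinv]
    rw [e, Real.fourierInv_eq']
    simp only [smul_eq_mul, hFH]
  -- the integrand on `(x, q)`
  set F : Space × Space → ℂ := fun z =>
    Complex.exp (((-2 * π * ⟪z.1, p⟫_ℝ : ℝ) : ℂ) * Complex.I) * Yc z.1 *
      (Complex.exp (((2 * π * ⟪z.2, z.1⟫_ℝ : ℝ) : ℂ) * Complex.I) * FH z.2) with hF
  have hphase1 : Continuous fun z : Space × Space =>
      Complex.exp (((-2 * π * ⟪z.1, p⟫_ℝ : ℝ) : ℂ) * Complex.I) :=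
    Complex.continuous_exp.comp ((Complex.continuous_ofReal.comp
      (continuous_const.mul (continuous_fst.inner continuous_const))).mul continuous_const)
  have hphase2 : Continuous fun z : Space × Space =>
      Complex.exp (((2 * π * ⟪z.2, z.1⟫_ℝ : ℝ) : ℂ) * Complex.I) :=
    Complex.continuous_exp.comp ((Complex.continuous_ofReal.comp
      (continuous_const.mul (continuous_snd.inner continuous_fst))).mul continuous_const)
  have hFi : Integrable F (volume.prod volume) := by
    have hprod : Integrable (fun z : Space × Space => Yc z.1 * FH z.2) (volume.prod volume) :=
      hYi.mul_prod hH
    refine hprod.norm.mono' ?_ (Eventually.of_forall fun z => ?_)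
    · exact ((hphase1.aestronglyMeasurable.mul hYi.aestronglyMeasurable.comp_fst).mul
        (hphase2.aestronglyMeasurable.mul hH.aestronglyMeasurable.comp_snd))
    · simp only [hF, norm_mul, Complex.norm_exp_ofReal_mul_I, one_mul]
      exact le_rfl
  -- left side as an iterated integral
  rw [Real.fourier_eq']
  simp only [smul_eq_mul]
  have hL : ∀ x : Space, Complex.exp (((-2 * π * ⟪x, p⟫_ℝ : ℝ) : ℂ) * Complex.I) *
      (((h x * (Real.exp (-(Real.sqrt m * ‖x‖)) / ‖x‖) : ℝ) : ℂ)) = ∫ q, F (x, q) := by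
    intro x
    simp only [hF]
    rw [integral_const_mul, ← hx x]
    simp only [hYc]
    push_cast
    ring
  simp_rw [hL]
  rw [integral_integral_swap hFi]
  refine integral_congr_ae (Eventually.of_forall fun q => ?_)
  -- inner integral: `FH q * 𝓕Yc(p - q)`
  have hYF := fourierIntegral_yukawa' hm (p - q)
  rw [Real.fourier_eq'] at hYF
  simp only [smul_eq_mul] at hYF
  have e : ∀ x : Space, F (x, q) = FH q *
      (Complex.exp (((-2 * π * ⟪x, p - q⟫_ℝ : ℝ) : ℂ) * Complex.I) *
        (((Real.exp (-(Real.sqrt m * ‖x‖)) / ‖x‖ : ℝ) : ℂ))) := by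
    intro x
    simp only [hF, hYc]
    have hexp : Complex.exp (((-2 * π * ⟪x, p⟫_ℝ : ℝ) : ℂ) * Complex.I) *
        Complex.exp (((2 * π * ⟪q, x⟫_ℝ : ℝ) : ℂ) * Complex.I) =
        Complex.exp (((-2 * π * ⟪x, p - q⟫_ℝ : ℝ) : ℂ) * Complex.I) := by
      rw [← Complex.exp_add, inner_sub_right, real_inner_comm q x]
      push_cast
      ring_nf
    rw [← hexp]
    ring
  simp_rw [e]
  rw [integral_const_mul, hYF]

/-- **Real form for an even cutoff**: if moreover `h(-x) = h(x)` then `𝓕h` is real and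
`𝓕(h · e^{-√m|·|}/|·|)(p) = ∫ Re𝓕h(q) · 4π/(4π²|p - q|² + m) dq` (a real number).
[cite: ConlonLiebYau1988, Lemma 2.1 (proof)] -/
theorem fourier_smearedYukawa_re {h : Space → ℝ} (hhc : Continuous h) (hhi : Integrable h)
    (hH : Integrable (𝓕 (fun x : Space => (h x : ℂ)))) (heven : ∀ x, h (-x) = h x) {m : ℝ}
    (hm : 0 < m) (p : Space) :
    𝓕 (fun x : Space => ((h x * (Real.exp (-(Real.sqrt m * ‖x‖)) / ‖x‖) : ℝ) : ℂ)) p =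
      ((∫ q, (𝓕 (fun x : Space => (h x : ℂ)) q).re *
        (4 * π / (4 * π ^ 2 * ‖p - q‖ ^ 2 + m)) : ℝ) : ℂ) := by
  rw [fourier_smearedYukawa hhc hhi hH hm p, ← integral_complex_ofReal]
  refine integral_congr_ae (Eventually.of_forall fun q => ?_)
  have hre : 𝓕 (fun x : Space => (h x : ℂ)) q = ((𝓕 (fun x : Space => (h x : ℂ)) q).re : ℂ) := by
    rw [← Complex.re_add_im (𝓕 (fun x : Space => (h x : ℂ)) q),
      fourier_ofReal_even_im_eq_zero hhi heven q]
    simp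
  dsimp only
  conv_lhs => rw [hre]
  push_cast
  ring

end Literature.MathematicalPhysics.QuantumManyBody.Coulomb
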